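import Summits.Ventures.PercRepro.C026DCSub
import Summits.Ventures.PercRepro.ClassHarris
import Summits.Ventures.PercRepro.C026HubLike

/-!
# Theorem P (b) and the general Harris bound on the deletion–contraction defect `DB(e)` (p6, gen 13)

mine-3's `proofs/MINE3-MONOTONICITY.md` §24, the two parts of THEOREM P not yet in the tree (p5's
`C026TheoremP` / `C026PendantMark` carry part (a) and its pendant-`b` consequence):

* **(b)** if the mark `c` is a pendant of `H` at `x` (`e = xc`, so `c` is isolated in `G = H − e`), the defect
  set is empty — `DB(e) = ∅` (`not_dcDefect_of_isolated`) — and the deletion–contraction identity of p5's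
  `slackCF_addEdge` (DC-SUB) is EXACT: `Δ_CF(H) = Δ_CF(H − e) + Δ_CF(H / e)` (`slackCF_addEdge_of_isolated`);
  moreover `Δ_CF(H − e) = 0` (`slackCF_of_isolated`), so `Δ_CF(G + xc) = Δ_CF(G / xc)` — a pendant mark has the
  slack of the mark placed at its neighbour (`slackCF_addEdge_eq_contract_of_isolated`), and (CF) is closed
  under hanging `c` as a pendant (`slackCF_nonneg_addEdge_of_isolated`);
* **the general Harris bound** at ANY non-loop edge `e = uv` of `H`:
  `#DB(e) ≤ #{S′ ⊆ E − e : c ~_{S′} a ∨ c ~_{S′} b}` (`card_dcDefect_le_card_conn`) — `DB(e) ⊆ {ω ∈ A, ωᶜ ∈ B}`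
  for the increasing events `A = {(a ~ u ∧ v ~ b) ∨ (a ~ v ∧ u ~ b)}` and
  `B = {(c ~ u ∧ (v ~ a ∨ v ~ b)) ∨ (c ~ v ∧ (u ~ a ∨ u ~ b))}`, Harris in typer-2's antipodal counting form
  (`card_inter_compl_le_card_inter`) bounds it by `#(A ∩ B)`, and on `A ∩ B` the mark `c` reaches `a` or `b`
  through `u` or `v`.

Definitions: p5's `slackCF` / `DCDefect` (`C026DefectFlips`, `C026DCSub`), p6's `Isolated` (`C026HubLike`).
-/

namespace PercRepro

open Finset

namespace MultiGraph

section DefectBound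

variable {V E : Type*} {G : MultiGraph V E}

/-- **Theorem P (b), the defect**: at an edge `e = xc` whose end `c` is isolated in `G = H − e`, `DB(e) = ∅` —
the open path of the defect would join `c` to `a` or `b` inside `G`, forcing `a = c` or `b = c`, against the
closed-cluster clauses `c ≁̄ a`, `c ≁̄ b`. -/
theorem not_dcDefect_of_isolated {ω : Config E} {a b c x : V} (hc : G.Isolated c) :
    ¬ G.DCDefect ω a b c x c := by
  rintro ⟨_, hop, hca, hcb, _⟩
  rcases hop with ⟨_, hcb'⟩ | ⟨hac, _⟩
  · have hb : b = c := (hc.conn_iff ω b).1 hcb'.symm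
    subst hb
    exact hcb (Conn.refl G ωᶜ b)
  · have ha : a = c := (hc.conn_iff ω a).1 hac
    subst ha
    exact hca (Conn.refl G ωᶜ a)

open Classical in
/-- **Theorem P (b)**: exact additivity of the C-026 slack at a pendant `c`-edge — for `H = G + xc` with `c`
isolated in `G` and `x` not a mark, `Δ_CF(H) = Δ_CF(H − e) + Δ_CF(H / e)` (DC-SUB with an empty defect). -/
theorem slackCF_addEdge_of_isolated [Fintype E] {x c : V} (hc : G.Isolated c) (hcx : c ≠ x) {a b : V}
    (ha : a ≠ x) (hb : b ≠ x) :
    (G.addEdge x c).slackCF a b c = G.slackCF a b c + (G.contract x c).slackCF a b c := by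
  rw [slackCF_addEdge hcx ha hb hcx]
  have h0 : (univ.filter fun ω : Config E => G.DCDefect ω a b c x c) = ∅ :=
    Finset.filter_eq_empty_iff.2 fun ω _ => not_dcDefect_of_isolated hc
  rw [h0, Finset.card_empty]
  simp

open Classical in
/-- With `c` isolated and `a, b ≠ c` the slack vanishes: the cells `ac|b`, `bc|a` are empty and `ab|c = N_AB`. -/
theorem slackCF_of_isolated [Fintype E] {c : V} (hc : G.Isolated c) {a b : V} (hac : a ≠ c) (hbc : b ≠ c) :
    G.slackCF a b c = 0 := by
  have h1 : ∀ ω : Config E, ¬ G.Conn ω a c := fun ω h => hac ((hc.conn_iff ω a).1 h)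
  have h2 : ∀ ω : Config E, ¬ G.Conn ω c a := fun ω h => hac ((hc.conn_iff ω a).1 h.symm)
  have h3 : ∀ ω : Config E, ¬ G.Conn ω c b := fun ω h => hbc ((hc.conn_iff ω b).1 h.symm)
  unfold slackCF
  simp only [h1, h2, h3, not_false_eq_true, and_true, Finset.filter_false, Finset.card_empty,
    Nat.cast_zero, add_zero, sub_self]

open Classical in
/-- **Theorem P (b), sharpened**: a pendant mark `c` hung at `x` has the slack of the mark placed at `x` —
`Δ_CF(G + xc) = Δ_CF(G / xc)` for `c` isolated in `G`, `x` not a mark, `a, b ≠ c` (the `p = ½` twin of the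
every-`p` pendant-mark transport `C026At_of_pendantMark` of `C026PendantMarkStep`). -/
theorem slackCF_addEdge_eq_contract_of_isolated [Fintype E] {x c : V} (hc : G.Isolated c) (hcx : c ≠ x)
    {a b : V} (ha : a ≠ x) (hb : b ≠ x) (hac : a ≠ c) (hbc : b ≠ c) :
    (G.addEdge x c).slackCF a b c = (G.contract x c).slackCF a b c := by
  rw [slackCF_addEdge_of_isolated hc hcx ha hb, slackCF_of_isolated hc hac hbc, zero_add]

open Classical in
/-- (CF) is closed under hanging the mark `c` as a pendant: C-026 at `p = ½` for `G / xc` gives it for `G + xc`. -/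
theorem slackCF_nonneg_addEdge_of_isolated [Fintype E] {x c : V} (hc : G.Isolated c) (hcx : c ≠ x)
    {a b : V} (ha : a ≠ x) (hb : b ≠ x) (hac : a ≠ c) (hbc : b ≠ c)
    (h : 0 ≤ (G.contract x c).slackCF a b c) : 0 ≤ (G.addEdge x c).slackCF a b c := by
  rw [slackCF_addEdge_eq_contract_of_isolated hc hcx ha hb hac hbc]
  exact h

/-- The defect lies in `{ω ∈ A, ωᶜ ∈ B}` for the two events of the Harris bound. -/
theorem dcDefect_imp_events {ω : Config E} {a b c u v : V} (h : G.DCDefect ω a b c u v) :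
    ((G.Conn ω a u ∧ G.Conn ω v b) ∨ (G.Conn ω a v ∧ G.Conn ω u b)) ∧
      ((G.Conn ωᶜ c u ∧ (G.Conn ωᶜ v a ∨ G.Conn ωᶜ v b)) ∨
        (G.Conn ωᶜ c v ∧ (G.Conn ωᶜ u a ∨ G.Conn ωᶜ u b))) := by
  obtain ⟨_, hop, _, _, hcl⟩ := h
  exact ⟨hop, hcl⟩

/-- On `A ∩ B` (both read in the same configuration) the mark `c` reaches `a` or `b`. -/
theorem conn_c_of_events {ω : Config E} {a b c u v : V}
    (hA : (G.Conn ω a u ∧ G.Conn ω v b) ∨ (G.Conn ω a v ∧ G.Conn ω u b))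
    (hB : (G.Conn ω c u ∧ (G.Conn ω v a ∨ G.Conn ω v b)) ∨
      (G.Conn ω c v ∧ (G.Conn ω u a ∨ G.Conn ω u b))) :
    G.Conn ω c a ∨ G.Conn ω c b := by
  rcases hA with ⟨hau, hvb⟩ | ⟨hav, hub⟩ <;> rcases hB with ⟨hcu, _⟩ | ⟨hcv, _⟩
  · exact Or.inl (hcu.trans hau.symm)
  · exact Or.inr (hcv.trans hvb)
  · exact Or.inr (hcu.trans hub)
  · exact Or.inl (hcv.trans hav.symm)

open Classical in
/-- **The general Harris bound** (mine-3 §24): for every edge `e = uv` of `H` and every marking,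
`#DB(e) ≤ #{S′ ⊆ E − e : c ~ a ∨ c ~ b}` — the deletion–contraction defect of `Δ_CF` at ANY edge is at most the
number of configurations of `H − e` in which `c` is joined to a mark. -/
theorem card_dcDefect_le_card_conn [Fintype E] (a b c u v : V) :
    (univ.filter fun ω : Config E => G.DCDefect ω a b c u v).card ≤
      (univ.filter fun ω : Config E => G.Conn ω c a ∨ G.Conn ω c b).card := by
  have hAup : IsUpperSet ((G.connEvent a u ∩ G.connEvent v b) ∪ (G.connEvent a v ∩ G.connEvent u b)) :=
    ((G.isUpperSet_connEvent a u).inter (G.isUpperSet_connEvent v b)).union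
      ((G.isUpperSet_connEvent a v).inter (G.isUpperSet_connEvent u b))
  have hBup : IsUpperSet ((G.connEvent c u ∩ (G.connEvent v a ∪ G.connEvent v b)) ∪
      (G.connEvent c v ∩ (G.connEvent u a ∪ G.connEvent u b))) :=
    ((G.isUpperSet_connEvent c u).inter
        ((G.isUpperSet_connEvent v a).union (G.isUpperSet_connEvent v b))).union
      ((G.isUpperSet_connEvent c v).inter
        ((G.isUpperSet_connEvent u a).union (G.isUpperSet_connEvent u b)))
  have h1 : (univ.filter fun ω : Config E => G.DCDefect ω a b c u v).card ≤
      (univ.filter fun ω : Config E =>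
        ((G.Conn ω a u ∧ G.Conn ω v b) ∨ (G.Conn ω a v ∧ G.Conn ω u b)) ∧
          ((G.Conn ωᶜ c u ∧ (G.Conn ωᶜ v a ∨ G.Conn ωᶜ v b)) ∨
            (G.Conn ωᶜ c v ∧ (G.Conn ωᶜ u a ∨ G.Conn ωᶜ u b)))).card := by
    refine Finset.card_le_card ?_
    intro ω hω
    simp only [Finset.mem_filter, Finset.mem_univ, true_and] at hω ⊢
    exact dcDefect_imp_events hω
  have h2 : (univ.filter fun ω : Config E =>
      ((G.Conn ω a u ∧ G.Conn ω v b) ∨ (G.Conn ω a v ∧ G.Conn ω u b)) ∧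
        ((G.Conn ωᶜ c u ∧ (G.Conn ωᶜ v a ∨ G.Conn ωᶜ v b)) ∨
          (G.Conn ωᶜ c v ∧ (G.Conn ωᶜ u a ∨ G.Conn ωᶜ u b)))).card ≤
      (univ.filter fun ω : Config E =>
        ((G.Conn ω a u ∧ G.Conn ω v b) ∨ (G.Conn ω a v ∧ G.Conn ω u b)) ∧
          ((G.Conn ω c u ∧ (G.Conn ω v a ∨ G.Conn ω v b)) ∨
            (G.Conn ω c v ∧ (G.Conn ω u a ∨ G.Conn ω u b)))).card := by
    have := card_inter_compl_le_card_inter _ _ hAup hBup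
    convert this using 4 <;> rfl
  refine le_trans h1 (le_trans h2 (Finset.card_le_card ?_))
  intro ω hω
  simp only [Finset.mem_filter, Finset.mem_univ, true_and] at hω ⊢
  exact conn_c_of_events hω.1 hω.2

end DefectBound

end MultiGraph

end PercRepro
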